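import Summits.RiemannHypothesis.RiemannHypothesis.Theorems.WeilTwoPrimeCellsX224Data0
import Literature.NumberTheory.LFunctions.WeilTwoPrimeCellsT120
import HarnessLib

/-!
# Two-prime minorant chain extension `[120, 224]`: multi-precision kernel check of cells 0–51

`TPDCell.checkZMP 120 5 weilTwoPrimeCellsT120MP` on chunk 0 of the extension, by `decide +kernel` (three parts, then the whole chunk by `List.all_append`). Pure proof file; nothing is asserted.
-/

set_option linter.dupNamespace false

noncomputable section

namespace Summit.RiemannHypothesis.RiemannHypothesis.Theorems.EvenWinsBeyondArch

open Literature.NumberTheory.LFunctions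

set_option maxHeartbeats 0 in
/-- Kernel check of cells `[0, 17)` of chunk 0. [folklore] -/
theorem checkCells_weilTwoPrimeCellsX224C0a :
    ((weilTwoPrimeCellsX224C0.take 17).all fun c ↦ c.checkZMP 120 5 weilTwoPrimeCellsT120MP) = true := by
  decide +kernel

set_option maxHeartbeats 0 in
/-- Kernel check of cells `[17, 34)` of chunk 0. [folklore] -/
theorem checkCells_weilTwoPrimeCellsX224C0b :
    (((weilTwoPrimeCellsX224C0.drop 17).take 17).all fun c ↦ c.checkZMP 120 5 weilTwoPrimeCellsT120MP) = true := by
  decide +kernel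

set_option maxHeartbeats 0 in
/-- Kernel check of cells `[34, end)` of chunk 0. [folklore] -/
theorem checkCells_weilTwoPrimeCellsX224C0c :
    (((weilTwoPrimeCellsX224C0.drop 17).drop 17).all fun c ↦ c.checkZMP 120 5 weilTwoPrimeCellsT120MP) = true := by
  decide +kernel

/-- **Kernel check of cells 0–51** (chunk 0) of the chain extension on `[120, 224]`. [folklore] -/
theorem checkCells_weilTwoPrimeCellsX224C0 :
    (weilTwoPrimeCellsX224C0.all fun c ↦ c.checkZMP 120 5 weilTwoPrimeCellsT120MP) = true := by
  rw [← List.take_append_drop 17 weilTwoPrimeCellsX224C0, List.all_append, checkCells_weilTwoPrimeCellsX224C0a, Bool.true_and,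
    ← List.take_append_drop 17 (weilTwoPrimeCellsX224C0.drop 17), List.all_append, checkCells_weilTwoPrimeCellsX224C0b, checkCells_weilTwoPrimeCellsX224C0c]
  rfl

end Summit.RiemannHypothesis.RiemannHypothesis.Theorems.EvenWinsBeyondArch
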